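import Summits.ResolutionOfSingularities.ResolutionOfSingularities.Theorems.FrobeniusLadderFRationalResolutionHomogeneousUnits
import Literature.RingTheory.GradedAlgebra.LocalizationDegreeZero
import Mathlib.RingTheory.Localization.AtPrime.Basic
import HarnessLib

/-!
# Crux `FrobeniusLadder.FRationalResolution` (stmt-ResolutionOfSingularities-15317), line `redirect`,
# stub `stub_diagonalizableQuotientResolution` — when every degree carries a homogeneous element
# outside `𝔔`, the localized quotient chart `T⁻¹S → (T⁻¹S)₀ = (S₀)_𝔮` is FREE on homogeneous units
# (the `D(B)`-torsor `Spec S^{(B_𝔔)} → Spec S₀` near `𝔮`; census item R3, second brick)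

Localized form of `…HomogeneousUnits`: for `S` graded by `B` (`GradedAlgebra 𝒯`) and a prime `𝔔`
such that EVERY degree `b` has some `s_b ∈ S_b ∖ 𝔔` (after coarsening by the unit-degree subgroup
this is the situation of `…Coarsening` / `…StabilizerSubgroup` for the ring `S^{(B_𝔔)}`), in the
localization `L = T⁻¹S`, `T = S₀ ∖ (𝔔 ∩ S₀)`, graded by `Literature.RingTheory.GradedAlgebra.locPiece`
with degree-`0` part `L₀ = (S₀)_𝔮`:

* `isUnit_algebraMap_of_forall_exists` — each `s_b` becomes a unit of `L` (`s_b s'_b ∈ S₀ ∖ 𝔮` for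
  `s'_b ∈ S_{−b} ∖ 𝔔`);
* `exists_basis_locPiece_zero` — **`L` is a free `L₀`-module with a basis of homogeneous units
  indexed by `B`** (finite free of rank `|B|` when `B` is finite: the torsor is finite flat, and
  étale iff `|B|` is invertible).

Honest label: brick of R3 (no stub closed; étaleness / the `p`-part descent are not here). No
definitions, no named facts, no sorry. [folklore; cite: SGA3, Exp. VIII §4–5]
-/

noncomputable section

-- single-problem summit: the doubled namespace component is forced
set_option linter.dupNamespace false

open DirectSum
open Literature.RingTheory.GradedAlgebra

namespace Summit.ResolutionOfSingularities.ResolutionOfSingularities.Theorems.FRationalResolution.LocalizedUnitsBasis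

universe u v w

variable {k : Type u} [CommRing k] {B : Type w} [DecidableEq B] [AddCommGroup B] {S : Type v}
  [CommRing S] [Algebra k S] (𝒯 : B → Submodule k S) [GradedAlgebra 𝒯]

/-- **A homogeneous element outside `𝔔` whose degree has a "partner" outside `𝔔` in the opposite
degree becomes a unit in `T⁻¹S`, `T = S₀ ∖ (𝔔 ∩ S₀)`**: `s s' ∈ S₀ ∖ 𝔔` is inverted. [folklore] -/
theorem isUnit_algebraMap_of_forall_exists (𝔔 : Ideal S) [𝔔.IsPrime] {b : B} {s s' : S}
    (hs : s ∈ 𝒯 b) (hsQ : s ∉ 𝔔) (hs' : s' ∈ 𝒯 (-b)) (hs'Q : s' ∉ 𝔔)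
    (L : Type v) [CommRing L] [Algebra S L]
    [IsLocalization ((𝔔.comap (algebraMap (𝒯 0) S)).primeCompl.map (algebraMap (𝒯 0) S)) L] :
    IsUnit (algebraMap S L s) := by
  have hss' : s * s' ∈ 𝒯 0 := by
    have h := SetLike.mul_mem_graded hs hs'
    rwa [add_neg_cancel] at h
  have hss'Q : s * s' ∉ 𝔔 := fun h => by
    rcases (inferInstance : 𝔔.IsPrime).mem_or_mem h with h1 | h1
    · exact hsQ h1
    · exact hs'Q h1
  have hmem : s * s' ∈ (𝔔.comap (algebraMap (𝒯 0) S)).primeCompl.map (algebraMap (𝒯 0) S) :=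
    ⟨⟨s * s', hss'⟩, hss'Q, rfl⟩
  have hunit : IsUnit (algebraMap S L (s * s')) := IsLocalization.map_units L ⟨s * s', hmem⟩
  rw [map_mul] at hunit
  exact isUnit_of_mul_isUnit_left hunit

/-- **The localized quotient chart is free on homogeneous units.** If every degree `b ∈ B` has an
element of `S_b` outside the prime `𝔔`, then the localization `L = T⁻¹S` (`T = S₀ ∖ (𝔔 ∩ S₀)`),
graded by `locPiece`, has a homogeneous unit in every degree, hence is a FREE module over its
degree-zero part `L₀ = (S₀)_𝔮` with a basis indexed by `B` consisting of images of homogeneous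
elements of `S` (`HomogeneousUnits.exists_basis_of_homogeneous_units`).
[folklore; cite: SGA3, Exp. VIII §4–5] -/
theorem exists_basis_locPiece_zero (𝔔 : Ideal S) [𝔔.IsPrime] (hunits : ∀ b : B, ∃ s ∈ 𝒯 b, s ∉ 𝔔)
    (L : Type v) [CommRing L] [Algebra S L] [Algebra k L] [IsScalarTower k S L]
    [IsLocalization ((𝔔.comap (algebraMap (𝒯 0) S)).primeCompl.map (algebraMap (𝒯 0) S)) L]
    (hT : ∀ t ∈ (𝔔.comap (algebraMap (𝒯 0) S)).primeCompl.map (algebraMap (𝒯 0) S), t ∈ 𝒯 0) :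
    letI := gradedMonoid_locPiece 𝒯 _ hT L
    ∃ basis : Module.Basis B
        (locPiece 𝒯 ((𝔔.comap (algebraMap (𝒯 0) S)).primeCompl.map (algebraMap (𝒯 0) S)) hT L 0) L,
      ∀ b, ∃ s ∈ 𝒯 b, s ∉ 𝔔 ∧ (basis b : L) = algebraMap S L s := by
  classical
  set T := (𝔔.comap (algebraMap (𝒯 0) S)).primeCompl.map (algebraMap (𝒯 0) S) with hTdef
  let ℒ := locPiece 𝒯 T hT L
  letI : GradedAlgebra ℒ := (nonempty_gradedAlgebra_locPiece 𝒯 T hT L).some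
  choose s hs hsQ using hunits
  have hu : ∀ b, algebraMap S L (s b) ∈ ℒ b := fun b => algebraMap_mem_locPiece hT (hs b)
  have hunit : ∀ b, IsUnit (algebraMap S L (s b)) := fun b =>
    isUnit_algebraMap_of_forall_exists 𝒯 𝔔 (hs b) (hsQ b) (hs (-b)) (hsQ (-b)) L
  obtain ⟨basis, hbasis⟩ :=
    HomogeneousUnits.exists_basis_of_homogeneous_units ℒ (fun b => algebraMap S L (s b)) hu hunit
  exact ⟨basis, fun b => ⟨s b, hs b, hsQ b, hbasis b⟩⟩

end Summit.ResolutionOfSingularities.ResolutionOfSingularities.Theorems.FRationalResolution.LocalizedUnitsBasis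

end
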